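import Summits.NavierStokesRegularity.NavierStokesRegularity.Theorems.CorkscrewDynamoCorkscrewProfileSharpRepresentative
import Summits.NavierStokesRegularity.NavierStokesRegularity.Theorems.CorkscrewDynamoCorkscrewProfileAngleTools
import Summits.NavierStokesRegularity.NavierStokesRegularity.Theorems.SqueezeCycleExtremalBiaxialitySubcriticalSmallConstant
import HarnessLib

/-!
# Route CorkscrewDynamo · crux `CorkscrewProfile` (stmt-NavierStokesRegularity-11282) — normal form, small-constant
# exclusion, and the irrational-angle bridge (lead c3, line `registered`)

Three facts about the crux itself (not about the relative-equilibrium stub), all through the sharp smooth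
representative `stub_sharpRepresentative`:

* `corkscrewProfile_iff_smooth` — POINTWISE NORMAL FORM: a corkscrew may be taken in the Oseen (KNSS) gauge
  `IsTypeIAncientMild C₀ V`, rotated `c`-DSS about `e₃` through `rotZLIE θ`, Type I with the same constant, with the
  essential-rotation clause stated pointwise (`∃ t < 0, ∃ x, R_θ V(t, R_{−θ} x) ≠ V(t, x)`); no measure theory left.
* `corkscrew_constant_lower_bound` — SMALL-CONSTANT EXCLUSION (the `ChaeWolf2017RemovingDSS` Rmk 1.4 analogue the
  planner asked for): there is an absolute `ε > 0` such that every corkscrew witness has Type-I constant `C₀ > ε`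
  (tree theorem `exists_typeIAncientMild_eq_zero_of_small`).
* `corkscrewProfile_of_irrational_rdss` — IRRATIONAL-ANGLE BRIDGE: a nontrivial Type-I ancient mild solution which is
  rotated `c`-DSS about `e₃` by an angle `θ` with `θ/2π` irrational is AUTOMATICALLY an essential corkscrew: were every
  slice a.e. `R_θ`-equivariant, the continuous representative would be equivariant under the dense group
  `ℤθ + 2πℤ`, hence axisymmetric, hence zero by KNSS 2009 Thm 5.3 (`knss_bound_C_over_r_holds`). Consequently
  `corkscrewProfile_of_not_rotatedTypeIDSSLiouville`: for such `(c, θ)` the crux follows from the failure of ONE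
  instance `RotatedTypeIDSSLiouville c (rotZLIE θ)` of Tsai's wall — the crux is the negative side of the rotated half
  of `TypeIDSSLiouvilleConjecture` up to the rational angles `θ ∈ 2πℚ ∖ 2πℤ`.
-/

noncomputable section

open Set Function MeasureTheory Filter Topology Literature.Analysis.FluidPDE

namespace Summit.NavierStokesRegularity.NavierStokesRegularity.Theorems.CorkscrewProfile.Birth

set_option linter.dupNamespace false

/-! ### The pointwise normal form -/

/-- **Normal form of `CorkscrewProfile`.** The crux holds iff there is a corkscrew in the Oseen (KNSS) gauge:
`c > 1`, an angle `θ`, a constant `C₀` and a field `V` with `IsTypeIAncientMild C₀ V`, rotated `c`-DSS about `e₃`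
through `rotZLIE θ`, Type I with constant `C₀`, whose rotation is essential POINTWISE: some negative slice is not
`R_θ`-equivariant at some point. (`→`: the sharp representative of a duality-form witness; a.e. plain DSS of `u` would
transfer to `V` and back. `←`: `V` is its own duality-form witness; a.e. plain DSS of a continuous slice is pointwise.) -/
theorem corkscrewProfile_iff_smooth :
    Summit.NavierStokesRegularity.NavierStokesRegularity.Theses.CorkscrewDynamo.CorkscrewProfile ↔
      ∃ (c θ C₀ : ℝ) (V : ℝ → EuclideanSpace ℝ (Fin 3) → EuclideanSpace ℝ (Fin 3)), 1 < c ∧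
        IsTypeIAncientMild C₀ V ∧ IsRotatedDSS c (rotZLIE θ) V ∧ HasTypeIDecay C₀ V ∧
        ∃ t < 0, ∃ x, rotZ θ (V t (rotZ (-θ) x)) ≠ V t x := by
  constructor
  · rintro ⟨c, θ, R, u, hc, hR, hmild, hmeas, hrdss, ⟨C₀, hTI⟩, hess, -⟩
    have hc0 : 0 < c := one_pos.trans hc
    obtain ⟨V, hV, hVdss, hVdec, hVu, -⟩ := stub_sharpRepresentative c R u C₀ hc0 hmild hmeas hrdss hTI
    have hRθ : R = rotZLIE θ := LinearIsometryEquiv.ext fun x => by rw [eq_rotZ_of_pinned hR, rotZLIE_apply]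
    refine ⟨c, θ, C₀, V, hc, hV, hRθ ▸ hVdss, hVdec, ?_⟩
    by_contra hcon
    push Not at hcon
    apply hess
    intro t ht
    -- `nsRescale c u t = nsRescale c V t = V t = u t` a.e.
    have h1 : nsRescale c u t =ᵐ[volume] nsRescale c V t :=
      (nsRescale_ae_congr hc0 (hVu (c ^ 2 * t) (mul_neg_of_pos_of_neg (by positivity) ht))).symm
    have h2 : nsRescale c V t = V t := funext fun x => by rw [nsRescale_eq_rotZ_conj hR hVdss, hcon t ht x]
    rw [h2] at h1
    exact h1.trans (hVu t ht)
  · rintro ⟨c, θ, C₀, V, hc, hV, hVdss, hVdec, t₀, ht₀, x₀, hx₀⟩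
    have hc0 : 0 < c := one_pos.trans hc
    have hR : ∀ x : EuclideanSpace ℝ (Fin 3), rotZLIE θ x 0 = Real.cos θ * x 0 - Real.sin θ * x 1 ∧
        rotZLIE θ x 1 = Real.sin θ * x 0 + Real.cos θ * x 1 ∧ rotZLIE θ x 2 = x 2 := rotZLIE_pinned_coord θ
    refine ⟨c, θ, rotZLIE θ, V, hc, hR, hV.isAncientMildSolution, fun t ht => hV.aestronglyMeasurable_slice ht,
      hVdss, ⟨C₀, hVdec⟩, fun hall => ?_, fun hall => ?_⟩
    · -- plain DSS a.e. on the continuous slice `t₀` is pointwise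
      have hae := hall t₀ ht₀
      have hct : c ^ 2 * t₀ < 0 := mul_neg_of_pos_of_neg (by positivity) ht₀
      have hcont : Continuous (nsRescale c V t₀) := by
        have e : nsRescale c V t₀ = fun x => c • V (c ^ 2 * t₀) (c • x) := funext fun x => nsRescale_apply _ _ _ _
        rw [e]
        exact ((hV.continuous_slice hct).comp (continuous_const_smul c)).const_smul c
      have heq := (Continuous.ae_eq_iff_eq volume hcont (hV.continuous_slice ht₀)).1 hae
      exact hx₀ (by rw [← nsRescale_eq_rotZ_conj hR hVdss t₀ x₀, heq])
    · -- nontriviality: `V t₀ = 0` would make the slice equivariant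
      have hae := hall t₀ ht₀
      have hVt : V t₀ = 0 := (Continuous.ae_eq_iff_eq volume (hV.continuous_slice ht₀) continuous_const).1 hae
      apply hx₀
      simp [hVt, rotZ_apply_zero_vec]

/-! ### Small-constant exclusion -/

/-- **No corkscrew with a small Type-I constant.** There is an absolute `ε > 0` such that every witness of
`CorkscrewProfile` — indeed every nontrivial Type-I rotated-DSS ancient mild solution — has Type-I constant `C₀ > ε`:
its sharp representative lies in the Oseen-gauge class with the same constant, which is `{0}` for `C₀ ≤ ε`
(`exists_typeIAncientMild_eq_zero_of_small`, a Kato fixed-point bound), and `V t = u t` a.e. transports triviality. -/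
theorem corkscrew_constant_lower_bound :
    ∃ ε : ℝ, 0 < ε ∧ ∀ (c : ℝ) (R : EuclideanSpace ℝ (Fin 3) ≃ₗᵢ[ℝ] EuclideanSpace ℝ (Fin 3))
      (u : ℝ → EuclideanSpace ℝ (Fin 3) → EuclideanSpace ℝ (Fin 3)) (C₀ : ℝ), 0 < c →
      IsAncientMildSolution 1 u → (∀ t < 0, AEStronglyMeasurable (u t) volume) → IsRotatedDSS c R u →
      HasTypeIDecay C₀ u → ¬ (∀ t < 0, u t =ᵐ[volume] 0) → ε < C₀ := by
  obtain ⟨ε, hε, hsmall⟩ :=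
    Summit.NavierStokesRegularity.NavierStokesRegularity.Theorems.exists_typeIAncientMild_eq_zero_of_small
  refine ⟨ε, hε, fun c R u C₀ hc hmild hmeas hrdss hTI hnz => ?_⟩
  by_contra hle
  push Not at hle
  obtain ⟨V, hV, -, -, hVu, -⟩ := stub_sharpRepresentative c R u C₀ hc hmild hmeas hrdss hTI
  apply hnz
  intro t ht
  have hVt : V t = 0 := funext fun x => hsmall C₀ V hV hle t ht x
  rw [← hVt]
  exact (hVu t ht).symm

/-- The crux form of the small-constant exclusion: every corkscrew witness has `C₀ > ε`. -/
theorem corkscrewProfile_constant_lower_bound :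
    ∃ ε : ℝ, 0 < ε ∧ ∀ (c θ : ℝ) (R : EuclideanSpace ℝ (Fin 3) ≃ₗᵢ[ℝ] EuclideanSpace ℝ (Fin 3))
      (u : ℝ → EuclideanSpace ℝ (Fin 3) → EuclideanSpace ℝ (Fin 3)) (C₀ : ℝ), 1 < c →
      (∀ x : EuclideanSpace ℝ (Fin 3), R x 0 = Real.cos θ * x 0 - Real.sin θ * x 1 ∧
        R x 1 = Real.sin θ * x 0 + Real.cos θ * x 1 ∧ R x 2 = x 2) →
      IsAncientMildSolution 1 u → (∀ t < 0, AEStronglyMeasurable (u t) volume) → IsRotatedDSS c R u →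
      HasTypeIDecay C₀ u → ¬ (∀ t < 0, nsRescale c u t =ᵐ[volume] u t) → ε < C₀ := by
  obtain ⟨ε, hε, h⟩ := corkscrew_constant_lower_bound
  refine ⟨ε, hε, fun c θ R u C₀ hc _ hmild hmeas hrdss hTI hess => h c R u C₀ (one_pos.trans hc) hmild hmeas hrdss
    hTI fun hall => hess fun t ht => ?_⟩
  -- a trivial field is plainly DSS a.e.
  have hc0 : 0 < c := one_pos.trans hc
  have h1 : nsRescale c (0 : ℝ → EuclideanSpace ℝ (Fin 3) → EuclideanSpace ℝ (Fin 3)) t =ᵐ[volume] nsRescale c u t :=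
    nsRescale_ae_congr hc0 (u := u) (V := 0)
      (hall (c ^ 2 * t) (mul_neg_of_pos_of_neg (by positivity) ht)).symm
  have h2 : nsRescale c (0 : ℝ → EuclideanSpace ℝ (Fin 3) → EuclideanSpace ℝ (Fin 3)) t = 0 := by
    funext x; simp [nsRescale_apply]
  rw [h2] at h1
  exact h1.symm.trans (hall t ht).symm

/-! ### The irrational-angle bridge -/

/-- **Irrational rotation angles are automatically essential.** Let `u` be a nontrivial Type-I ancient mild solution
(duality form, measurable slices) which is rotated `c`-DSS about `e₃` through a coordinate-pinned rotation by `θ`, with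
`c > 1` and `θ/2π` IRRATIONAL. Then `u` is a corkscrew: if every negative slice were a.e. plainly `c`-DSS, the sharp
representative `V` would be plainly DSS pointwise, i.e. every slice `R_θ`-equivariant, hence (density of `ℤθ + 2πℤ`,
continuity) axisymmetric, hence `V ≡ 0` by KNSS Thm 5.3, hence `u t = 0` a.e. for all `t < 0`. -/
theorem corkscrewProfile_of_irrational_rdss {c θ : ℝ} (hc : 1 < c) (hθ : Irrational (θ / (2 * Real.pi)))
    {R : EuclideanSpace ℝ (Fin 3) ≃ₗᵢ[ℝ] EuclideanSpace ℝ (Fin 3)}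
    (hR : ∀ x : EuclideanSpace ℝ (Fin 3), R x 0 = Real.cos θ * x 0 - Real.sin θ * x 1 ∧
      R x 1 = Real.sin θ * x 0 + Real.cos θ * x 1 ∧ R x 2 = x 2)
    {u : ℝ → EuclideanSpace ℝ (Fin 3) → EuclideanSpace ℝ (Fin 3)} (hmild : IsAncientMildSolution 1 u)
    (hmeas : ∀ t < 0, AEStronglyMeasurable (u t) volume) (hrdss : IsRotatedDSS c R u)
    (hTI : ∃ C₀ : ℝ, HasTypeIDecay C₀ u) (hnz : ¬ ∀ t < 0, u t =ᵐ[volume] 0) :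
    Summit.NavierStokesRegularity.NavierStokesRegularity.Theses.CorkscrewDynamo.CorkscrewProfile := by
  obtain ⟨C₀, hTI⟩ := hTI
  have hc0 : 0 < c := one_pos.trans hc
  refine ⟨c, θ, R, u, hc, hR, hmild, hmeas, hrdss, ⟨C₀, hTI⟩, fun hall => hnz fun t ht => ?_, hnz⟩
  obtain ⟨V, hV, hVdss, hVdec, hVu, -⟩ := stub_sharpRepresentative c R u C₀ hc0 hmild hmeas hrdss hTI
  -- every slice of `V` is `R_θ`-equivariant, pointwise
  have hequiv : ∀ s < 0, ∀ y, V s (rotZ θ y) = rotZ θ (V s y) := by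
    intro s hs y
    have hcs : c ^ 2 * s < 0 := mul_neg_of_pos_of_neg (by positivity) hs
    have h1 : nsRescale c V s =ᵐ[volume] V s :=
      ((nsRescale_ae_congr hc0 (hVu (c ^ 2 * s) hcs)).trans (hall s hs)).trans (hVu s hs).symm
    have hcont : Continuous (nsRescale c V s) := by
      have e : nsRescale c V s = fun x => c • V (c ^ 2 * s) (c • x) := funext fun x => nsRescale_apply _ _ _ _
      rw [e]
      exact ((hV.continuous_slice hcs).comp (continuous_const_smul c)).const_smul c
    have heq := congrFun ((Continuous.ae_eq_iff_eq volume hcont (hV.continuous_slice hs)).1 h1) (rotZ θ y)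
    rw [nsRescale_eq_rotZ_conj hR hVdss, ← rotZ_add, neg_add_cancel, rotZ_zero] at heq
    exact heq.symm
  -- hence axisymmetric, hence zero
  have hax : ∀ s < 0, IsAxisymmetric (V s) := fun s hs =>
    isAxisymmetric_of_equivariant_irrational (hV.continuous_slice hs) hθ (hequiv s hs)
  have hVt : V t = 0 := funext fun x => typeIAncientMild_eq_zero_of_isAxisymmetric hV hVdec hax ht x
  rw [← hVt]
  exact (hVu t ht).symm

/-- **The crux from ONE failed instance of the rotated wall at an irrational angle.** If for some `c > 1` and some
`θ` with `θ/2π` irrational the Liouville statement `RotatedTypeIDSSLiouville c (rotZLIE θ)` fails, then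
`CorkscrewProfile` holds. -/
theorem corkscrewProfile_of_not_rotatedTypeIDSSLiouville {c θ : ℝ} (hc : 1 < c)
    (hθ : Irrational (θ / (2 * Real.pi))) (h : ¬ RotatedTypeIDSSLiouville c (rotZLIE θ)) :
    Summit.NavierStokesRegularity.NavierStokesRegularity.Theses.CorkscrewDynamo.CorkscrewProfile := by
  unfold RotatedTypeIDSSLiouville at h
  push Not at h
  obtain ⟨-, u, hmild, hmeas, hrdss, hTI, hnz⟩ := h
  refine corkscrewProfile_of_irrational_rdss hc hθ (rotZLIE_pinned_coord θ) hmild hmeas hrdss hTI ?_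
  intro hall
  obtain ⟨t, ht, hne⟩ := hnz
  exact hne (hall t ht)

/-- **Conversely, a corkscrew refutes one instance of the rotated wall at a non-integer angle**: from a witness
`(c, θ, R, u)` of `CorkscrewProfile`, `RotatedTypeIDSSLiouville c (rotZLIE θ)` fails and `cos θ ≠ 1` (for
`θ ∈ 2πℤ` the rotation is the identity and the slices would be plainly DSS). -/
theorem exists_not_rotatedTypeIDSSLiouville_of_corkscrewProfile
    (h : Summit.NavierStokesRegularity.NavierStokesRegularity.Theses.CorkscrewDynamo.CorkscrewProfile) :
    ∃ c θ : ℝ, 1 < c ∧ Real.cos θ ≠ 1 ∧ ¬ RotatedTypeIDSSLiouville c (rotZLIE θ) := by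
  obtain ⟨c, θ, R, u, hc, hR, hmild, hmeas, hrdss, hTI, hess, hnz⟩ := h
  have hRθ : R = rotZLIE θ := LinearIsometryEquiv.ext fun x => by rw [eq_rotZ_of_pinned hR, rotZLIE_apply]
  refine ⟨c, θ, hc, fun hcos => hess fun t _ => ?_, fun hL => hnz (hL hc u hmild hmeas (hRθ ▸ hrdss) hTI)⟩
  -- `cos θ = 1`: the rotation is trivial and every slice is plainly DSS on the nose
  have hsin : Real.sin θ = 0 := by
    have h1 := Real.sin_sq_add_cos_sq θ
    rw [hcos] at h1
    nlinarith
  have hid : ∀ x : EuclideanSpace ℝ (Fin 3), rotZ θ x = x := fun x => by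
    ext i; fin_cases i <;> simp [hcos, hsin]
  have hid' : ∀ x : EuclideanSpace ℝ (Fin 3), rotZ (-θ) x = x := fun x => by
    ext i; fin_cases i <;> simp [hcos, hsin, Real.cos_neg, Real.sin_neg]
  refine Filter.EventuallyEq.of_eq (funext fun x => ?_)
  rw [nsRescale_eq_rotZ_conj hR hrdss, hid', hid]


/-! ### The sibling target gives an irrational-angle witness -/

/-- **An RSS profile refutes the rotated wall at an irrational angle.** From `RssProfileExists` (route
`FilamentSkeletonRss`, stmt-NavierStokesRegularity-16274: a nontrivial profile turning at rate `α ≠ 0`, rotated DSS for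
EVERY factor) pick the factor `c = e^s` with `α s = ± √2 π`: the rotation angle `θ = −2α s` has `θ/2π = ∓ √2`
irrational, and `u` (nontrivial at `t = −1`, where its slice is the continuous `U ≠ 0`) violates
`RotatedTypeIDSSLiouville c (rotZLIE θ)`. So the hypothesis of `corkscrewProfile_of_not_rotatedTypeIDSSLiouville` is
implied by the registered open stub of the line, and is the weakest sufficient condition on record. -/
theorem exists_irrational_not_rotatedTypeIDSSLiouville_of_rssProfileExists
    (h : Summit.NavierStokesRegularity.NavierStokesRegularity.Theses.FilamentSkeletonRss.RssProfileExists) :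
    ∃ c θ : ℝ, 1 < c ∧ Irrational (θ / (2 * Real.pi)) ∧ ¬ RotatedTypeIDSSLiouville c (rotZLIE θ) := by
  obtain ⟨α, C₀, U, Rot, u, hα, hRot, hU2, hU0, hslice, hrdss, hmild, hmeas, hTI⟩ := h
  have hπ : Real.pi ≠ 0 := Real.pi_ne_zero
  -- any `s > 0` with `α s / π` irrational will do; take `α s = ± √2 π`
  obtain ⟨s, hs, hirr⟩ : ∃ s : ℝ, 0 < s ∧ Irrational (-(α * (2 * s)) / (2 * Real.pi)) := by
    rcases lt_or_gt_of_ne hα with hneg | hpos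
    · refine ⟨-(Real.sqrt 2 * Real.pi / α), ?_, ?_⟩
      · have : Real.sqrt 2 * Real.pi / α < 0 := div_neg_of_pos_of_neg (by positivity) hneg
        linarith
      · have e : -(α * (2 * -(Real.sqrt 2 * Real.pi / α))) / (2 * Real.pi) = Real.sqrt 2 := by
          field_simp
        rw [e]
        exact irrational_sqrt_two
    · refine ⟨Real.sqrt 2 * Real.pi / α, by positivity, ?_⟩
      have e : -(α * (2 * (Real.sqrt 2 * Real.pi / α))) / (2 * Real.pi) = -Real.sqrt 2 := by
        field_simp
      rw [e]
      exact irrational_sqrt_two.neg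
  set c : ℝ := Real.exp s with hc_def
  have hc1 : 1 < c := Real.one_lt_exp_iff.2 hs
  have hc0 : 0 < c := Real.exp_pos s
  have hlog : Real.log c = s := Real.log_exp s
  refine ⟨c, -(α * (2 * s)), hc1, hirr, fun hL => hU0 ?_⟩
  have hR : Rot (-(α * (2 * Real.log c))) = rotZLIE (-(α * (2 * s))) :=
    LinearIsometryEquiv.ext fun x => by rw [rot_apply_eq_rotZ_of_basis hRot, hlog, rotZLIE_apply]
  have hae := hL hc1 u hmild hmeas (hR ▸ hrdss c hc0) ⟨C₀, hTI⟩ (-1) (by norm_num)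
  rw [hslice] at hae
  exact (Continuous.ae_eq_iff_eq volume hU2.continuous continuous_const).1 hae

/-! ### Registered tools stub -/

/-- **Registered tools stub `stub_corkscrewNormalForm`** (crux stmt-NavierStokesRegularity-11282, line `registered`, lead
c3): the pointwise normal form of the crux, the small-constant exclusion, and the irrational-angle bridge from one failed
instance of the rotated Type-I DSS Liouville wall. -/
theorem stub_corkscrewNormalForm :
    (Summit.NavierStokesRegularity.NavierStokesRegularity.Theses.CorkscrewDynamo.CorkscrewProfile ↔
      ∃ (c θ C₀ : ℝ) (V : ℝ → EuclideanSpace ℝ (Fin 3) → EuclideanSpace ℝ (Fin 3)), 1 < c ∧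
        Literature.Analysis.FluidPDE.IsTypeIAncientMild C₀ V ∧
        Literature.Analysis.FluidPDE.IsRotatedDSS c (Literature.Analysis.FluidPDE.rotZLIE θ) V ∧
        Literature.Analysis.FluidPDE.HasTypeIDecay C₀ V ∧
        ∃ t < 0, ∃ x, Literature.Analysis.FluidPDE.rotZ θ (V t (Literature.Analysis.FluidPDE.rotZ (-θ) x)) ≠ V t x) ∧
    (∃ ε : ℝ, 0 < ε ∧ ∀ (c : ℝ) (R : EuclideanSpace ℝ (Fin 3) ≃ₗᵢ[ℝ] EuclideanSpace ℝ (Fin 3))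
      (u : ℝ → EuclideanSpace ℝ (Fin 3) → EuclideanSpace ℝ (Fin 3)) (C₀ : ℝ), 0 < c →
      Literature.Analysis.FluidPDE.IsAncientMildSolution 1 u → (∀ t < 0, AEStronglyMeasurable (u t) volume) →
      Literature.Analysis.FluidPDE.IsRotatedDSS c R u → Literature.Analysis.FluidPDE.HasTypeIDecay C₀ u →
      ¬ (∀ t < 0, u t =ᵐ[volume] 0) → ε < C₀) ∧
    (∀ (c θ : ℝ), 1 < c → Irrational (θ / (2 * Real.pi)) →
      ¬ Literature.Analysis.FluidPDE.RotatedTypeIDSSLiouville c (Literature.Analysis.FluidPDE.rotZLIE θ) →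
      Summit.NavierStokesRegularity.NavierStokesRegularity.Theses.CorkscrewDynamo.CorkscrewProfile) :=
  ⟨corkscrewProfile_iff_smooth, corkscrew_constant_lower_bound,
    fun _ _ hc hθ h => corkscrewProfile_of_not_rotatedTypeIDSSLiouville hc hθ h⟩

end Summit.NavierStokesRegularity.NavierStokesRegularity.Theorems.CorkscrewProfile.Birth

end
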